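import Summits.NavierStokesRegularity.NavierStokesRegularity.Theorems.TypeILiouvilleTypeIliouvilleLOseenGauge
import Literature.Analysis.FluidPDE.KNSSTypeIRateLiouvilleMild
import Literature.Analysis.FluidPDE.KNSSRemark61
import HarnessLib

/-!
# The crux `TypeIliouvilleL` is exactly KNSS's conjecture (L) for mild bounded ancient solutions
# (stmt-NavierStokesRegularity-10661, line `registered`)

Support file for the crux `TypeIliouvilleL` (the Liouville conjecture (L) of
Koch–Nadirashvili–Seregin–Šverák 2009 over the tree's duality-form class
`Literature.Analysis.FluidPDE.IsBoundedAncientMildSolution`, slice-wise a.e.-strongly measurable,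
conclusion "every slice is a.e. constant"). Print states (L) for its own class of **mild bounded
ancient solutions** (KNSS 2009 §1 p. 3 and §4 (i): bounded fields on `ℝ³ × (−∞,0)` solving the
Oseen integral equation `u(t) = e^{(t−s)Δ}u(s) − B¹_s(u,u)(t)`; such fields are automatically
smooth, (4.6)–(4.7)) with the conclusion "`u` is constant". This file proves, kernel-checked, that
the two statements are EQUIVALENT:

* `TypeIliouvilleL_iff_oseenMild_liouville` — `TypeIliouvilleL` holds iff every field `v` which is
  continuous and uniformly bounded on `(−∞,0) × ℝ³`, weakly divergence free on every slice, and
  Oseen-mild for all `s < t < 0` is constant in space AND time.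

Direction →: an Oseen-mild bounded continuous ancient field is in the duality-form class
(`Literature.Analysis.FluidPDE.isBoundedAncientMildSolution_of_oseen`, Lemarié-Rieusset 2016
Thm 6.1), its slices are continuous, so "a.e. constant" upgrades to "constant"
(`Continuous.ae_eq_iff_eq`), and KNSS Remark 6.1 (`KNSS2009_remark61`: the Duhamel term of
spatial constants vanishes) makes the constant time-independent. Direction ←: the landed **Oseen
gauge theorem** `oseen_gauge_of_aestronglyMeasurable` (every member of the crux's class is, at
every `t < 0` and a.e. in space, a Galilean image `x ↦ v(t, x − A(t)) + c(t)` of ONE such `v`).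
So the item is neither weaker nor stronger than the printed conjecture: the parasitic drift
`b(t)` and the measurability conventions of the tree's class are exactly quotiented out.

No new definitions; theorems only.

## References

* G. Koch, N. Nadirashvili, G. Seregin, V. Šverák, *Liouville theorems for the Navier–Stokes
  equations and applications*, Acta Math. 203 (2009) 83–105 = arXiv:0709.3599, §1 p. 3
  (conjecture (L), mild vs weak bounded ancient solutions, parasitic solutions), §4 (i)–(ii),
  Remark 6.1 p. 11. [KochNadirashviliSereginSverak2009]
* P. G. Lemarié-Rieusset, *The Navier–Stokes Problem in the 21st Century* (2016), Thm 6.1.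
  [LemarieRieusset2016]
-/

-- the summit and its single problem share the name (D-0017 nested layout)
set_option linter.dupNamespace false

noncomputable section

open MeasureTheory Filter Set Function Metric
open scoped Topology ENNReal

namespace Summit.NavierStokesRegularity.NavierStokesRegularity.Theorems

namespace TypeIliouvilleL.MildGauge

/-- **(L) for the duality-form class ⇒ (L) for print's mild class.** Under `TypeIliouvilleL`,
every continuous, uniformly bounded, weakly divergence-free, Oseen-mild ancient field on
`(−∞,0) × ℝ³` is constant in space and time. -/
theorem oseenMild_const_of_TypeIliouvilleL
    (hL : Summit.NavierStokesRegularity.NavierStokesRegularity.Theses.TypeILiouville.TypeIliouvilleL)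
    (v : ℝ → EuclideanSpace ℝ (Fin 3) → EuclideanSpace ℝ (Fin 3))
    (hcont : ContinuousOn (uncurry v) (Iio 0 ×ˢ univ))
    (hbdd : ∃ K : ℝ, ∀ t < 0, ∀ x, ‖v t x‖ ≤ K)
    (hdiv : ∀ t < 0, Literature.Analysis.FluidPDE.IsWeaklyDivFree (v t))
    (hmild : ∀ s t : ℝ, s < t → t < 0 → ∀ x,
      v t x = Literature.Analysis.UnboundedOperators.heatExtension (v s) (t - s) x -
        Literature.Analysis.FluidPDE.oseenDuhamel 1 s v v t x) :
    ∃ b : EuclideanSpace ℝ (Fin 3), ∀ t < 0, ∀ x, v t x = b := by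
  classical
  -- the Oseen identity with the viscosity written as `1 * (t - s)`
  have hmild1 : ∀ s t : ℝ, s < t → t < 0 → ∀ x,
      v t x = Literature.Analysis.UnboundedOperators.heatExtension (v s) (1 * (t - s)) x -
        Literature.Analysis.FluidPDE.oseenDuhamel 1 s v v t x := by
    intro s t hst ht x
    rw [one_mul]
    exact hmild s t hst ht x
  -- membership in the duality-form class, measurable slices
  have hv : Literature.Analysis.FluidPDE.IsBoundedAncientMildSolution 1 v :=
    Literature.Analysis.FluidPDE.isBoundedAncientMildSolution_of_oseen one_pos hcont hbdd hdiv hmild1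
  -- slices are continuous (landed as `ParabolicGaldiLiouville.Birth.KnownCases.continuous_slice`;
  -- inlined here to keep the import cone small)
  have hvc : ∀ t < 0, Continuous (v t) := fun t ht =>
    hcont.comp_continuous (Continuous.prodMk_right t) fun x => mem_prod.2 ⟨ht, mem_univ x⟩
  have hmeas : ∀ t < 0, AEStronglyMeasurable (v t) volume := fun t ht =>
    (hvc t ht).aestronglyMeasurable
  -- every slice is constant
  have hslice : ∀ t < 0, ∃ b : EuclideanSpace ℝ (Fin 3), ∀ x, v t x = b := by
    intro t ht
    obtain ⟨b, hb⟩ := hL v hv hmeas t ht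
    have : v t = fun _ => b :=
      (Continuous.ae_eq_iff_eq volume (hvc t ht) continuous_const).1 hb
    exact ⟨b, fun x => congrFun this x⟩
  -- the slice constants as a function of time
  set b : ℝ → EuclideanSpace ℝ (Fin 3) := fun t =>
    if ht : t < 0 then Classical.choose (hslice t ht) else 0 with hb_def
  have hub : ∀ t < 0, ∀ x, v t x = b t := by
    intro t ht x
    have h := Classical.choose_spec (hslice t ht) x
    simp only [hb_def, dif_pos ht]
    exact h
  -- KNSS Remark 6.1: the constant does not depend on time
  have htime : ∀ s t : ℝ, s < 0 → t < 0 → b s = b t :=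
    Literature.Analysis.FluidPDE.KNSS2009_remark61 one_pos hub
      fun s t hst ht => Eventually.of_forall fun x => hmild1 s t hst ht x
  refine ⟨b (-1), fun t ht x => ?_⟩
  rw [hub t ht x, htime t (-1) ht (by norm_num)]

/-- **(L) for print's mild class ⇒ (L) for the duality-form class**, through the landed Oseen gauge
theorem `oseen_gauge_of_aestronglyMeasurable`: a member `u` of the crux's class is, at every
`t < 0` and a.e. in space, `x ↦ v(t, x − A(t)) + c(t)` for one bounded continuous Oseen-mild `v`;
if `v ≡ b` then `u(t) = b + c(t)` a.e. -/
theorem TypeIliouvilleL_of_oseenMild_const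
    (hM : ∀ v : ℝ → EuclideanSpace ℝ (Fin 3) → EuclideanSpace ℝ (Fin 3),
      ContinuousOn (uncurry v) (Iio 0 ×ˢ univ) →
      (∃ K : ℝ, ∀ t < 0, ∀ x, ‖v t x‖ ≤ K) →
      (∀ t < 0, Literature.Analysis.FluidPDE.IsWeaklyDivFree (v t)) →
      (∀ s t : ℝ, s < t → t < 0 → ∀ x,
        v t x = Literature.Analysis.UnboundedOperators.heatExtension (v s) (t - s) x -
          Literature.Analysis.FluidPDE.oseenDuhamel 1 s v v t x) →
      ∃ b : EuclideanSpace ℝ (Fin 3), ∀ t < 0, ∀ x, v t x = b) :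
    Summit.NavierStokesRegularity.NavierStokesRegularity.Theses.TypeILiouville.TypeIliouvilleL := by
  intro u hu hmeas t ht
  obtain ⟨v, A, c, -, hvc, hvK, hvd, hvm, -, hrep⟩ := oseen_gauge_of_aestronglyMeasurable u hu hmeas
  obtain ⟨b, hb⟩ := hM v hvc hvK hvd hvm
  refine ⟨b + c t, ?_⟩
  filter_upwards [hrep t ht] with x hx
  rw [hx, hb t ht]

end TypeIliouvilleL.MildGauge

open TypeIliouvilleL.MildGauge

/-- **The crux is exactly KNSS's conjecture (L) for mild bounded ancient solutions.**
`TypeIliouvilleL` (every bounded ancient mild solution of the duality-form class with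
a.e.-strongly measurable slices is a.e. constant on every slice) holds iff every field on
`(−∞,0) × ℝ³` which is continuous and uniformly bounded, weakly divergence free on every slice,
and solves the Oseen integral equation `v(t) = e^{(t−s)Δ}v(s) − B¹_s(v,v)(t)` for all
`s < t < 0` — print's class of mild bounded ancient solutions (KNSS 2009 §1 p. 3, §4 (i)) — is
constant in space and time. (→: `oseenMild_const_of_TypeIliouvilleL`; ←:
`TypeIliouvilleL_of_oseenMild_const`, the Oseen gauge theorem.)
[cite: KochNadirashviliSereginSverak2009, §1 p. 3 and §4 (i), Remark 6.1 (arXiv:0709.3599)] -/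
theorem TypeIliouvilleL_iff_oseenMild_liouville :
    Summit.NavierStokesRegularity.NavierStokesRegularity.Theses.TypeILiouville.TypeIliouvilleL ↔
    ∀ v : ℝ → EuclideanSpace ℝ (Fin 3) → EuclideanSpace ℝ (Fin 3),
      ContinuousOn (uncurry v) (Iio 0 ×ˢ univ) →
      (∃ K : ℝ, ∀ t < 0, ∀ x, ‖v t x‖ ≤ K) →
      (∀ t < 0, Literature.Analysis.FluidPDE.IsWeaklyDivFree (v t)) →
      (∀ s t : ℝ, s < t → t < 0 → ∀ x,
        v t x = Literature.Analysis.UnboundedOperators.heatExtension (v s) (t - s) x -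
          Literature.Analysis.FluidPDE.oseenDuhamel 1 s v v t x) →
      ∃ b : EuclideanSpace ℝ (Fin 3), ∀ t < 0, ∀ x, v t x = b :=
  ⟨fun hL v hc hK hd hm => oseenMild_const_of_TypeIliouvilleL hL v hc hK hd hm,
    fun hM => TypeIliouvilleL_of_oseenMild_const hM⟩

end Summit.NavierStokesRegularity.NavierStokesRegularity.Theorems
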